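import Mathlib
import Literature.Computability.AlgebraicComplexity.NewtonPolygonTau
import Summits.ValiantsHypothesis.ValiantsHypothesis.Theorems.NewtonUnitEquationsTwoProductsFormalLogLinearisationDefs
import Summits.ValiantsHypothesis.ValiantsHypothesis.Theorems.NewtonUnitEquationsTwoProductsFormalLogLinearisationTame
import Summits.ValiantsHypothesis.ValiantsHypothesis.Theorems.NewtonUnitEquationsTwoProductsFormalLogLinearisationSectorDecomposition
import Summits.ValiantsHypothesis.ValiantsHypothesis.Theorems.NewtonUnitEquationsTwoProductsFormalLogLinearisationStructuredChart
import Summits.ValiantsHypothesis.ValiantsHypothesis.Theorems.NewtonUnitEquationsTwoProductsFormalLogLinearisationStubLogLinearisation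
import Summits.ValiantsHypothesis.ValiantsHypothesis.Theorems.NewtonUnitEquationsTwoProductsFormalLogLinearisationEngineCommonConeRung
import HarnessLib

/-!
# Route NewtonUnitEquations — crux `TwoProducts` (stmt-ValiantsHypothesis-5906): pencils of COMMON-SHAPE trinomials
# have polynomially many Newton vertices (an unconditional `t = 3` family, end-to-end through the
# line `formal-log-linearisation`)

The crux `TwoProducts` asks for `#vert Newt(∏_{j<m} f_j − ∏_{j<m} g_j) ≤ 2^(a m)·(t+2)^b` for `t`-sparse factors;
it is OPEN for every `t ≥ 3` (the tree's unconditional end-to-end families are the binomial ones, `t ≤ 2`: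
`TwoProducts.Reduction.twoProducts_sparsity_le_two`, route item `BinomialPencil`). This file proves the first
`t = 3` family:

* `twoProducts_commonShape` — if all `2m` factors are supported on TRANSLATES OF ONE SET `S ⊂ ℕ²` with `#S ≤ 3`
  (pencils of common-shape trinomials `c_j X^{o_j}(1 + α_j X^{d₁} + β_j X^{d₂})`, `c'_j X^{o'_j}(1 + α'_j X^{d₁}
  + β'_j X^{d₂})`, all coefficients nonzero; degenerate shapes included), then
  `#vert Newt(∏ f − ∏ g) ≤ 12 m² + 12 m + 2`.

Proof — the line `Cruxes/TwoProducts/Lines/formal-log-linearisation.lean` run END TO END, by name: STUB 1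
(`stub_sectorDecomposition`, sector decomposition: `V ≤ 4mt + 2 + 2mt·B` with `t = 3`) reduces to bounding the
hidden vertices of each cancelling top-assignment `(a, b)` by `B = 2m`; if `(a, b)` is realised by a weight `ξ₀`,
ALL `2m` strict tops sit at the same relative position `s⋆ ∈ S` (the strict `ξ₀`-top of the shape,
`top_eq_add_of_shape`), so all relative tails lie in the common pair `S ∖ {s⋆} − s⋆`; the STRUCTURED chart
(`chartNormalisation_structured`) maps them to a common pair `{e₁, e₂} ⊂ ℕ²`, i.e. the normalised tails `u_j, v_j`
are supported in `{e₁, e₂}` (`support_subset_pair_of_shape`); STUB 3 (`stub_logLinearisation`, via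
`visible_ncard_le_logBound`) turns visible vertices into visible points of `supp D`, and the COMMON-CONE RUNG
(`engineCommonConeRung`) bounds those by `2m`. (The sharper sector count — the Minkowski sum of `2m` translates of
`S` has `≤ 3` hull vertices — would give a LINEAR bound; the quadratic one is what the line's stub 1 yields by
name.)

Honest framing: a thin unconditional partial range of the OPEN crux `TwoProducts` (the engine
`stub_logSumEngine` is NOT used and stays OPEN); nothing here is progress on `VP ≠ VNP` (NOT proved). No
definitions, no named facts.
-/

set_option linter.dupNamespace false

noncomputable section

open scoped BigOperators
open MvPolynomial Literature.Computability.AlgebraicComplexity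

namespace Summit.ValiantsHypothesis.ValiantsHypothesis.Theorems.NewtonUnitEquations.TwoProducts.FormalLogLinearisation

variable {m : ℕ}

/-! ### Strict tops of translates of a common shape -/

/-- Strict tops are unique. [folklore] -/
theorem isStrictTop_unique_of_shape {ξ : Fin 2 → ℝ} {T : Set Expo} {l l' : Expo} (h : IsStrictTop ξ T l)
    (h' : IsStrictTop ξ T l') : l = l' := by
  by_contra hne
  have h1 := h.2 l' h'.1 (Ne.symm hne)
  have h2 := h'.2 l h.1 hne
  exact lt_asymm h1 h2

/-- The strict top of a translate `o + S` is `o + (strict top of S)`: if `a` is the strict `ξ`-top of the support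
`o + S`, then `a = o + s` for an `s ∈ S` which is the strict `ξ`-top of `S`. [folklore] -/
theorem exists_top_of_shape {ξ : Fin 2 → ℝ} {S : Finset Expo} {o a : Expo} {F : Finset Expo}
    (hF : F = S.image (o + ·)) (ha : IsStrictTop ξ ↑F a) : ∃ s ∈ S, a = o + s ∧ IsStrictTop ξ ↑S s := by
  classical
  obtain ⟨haF, hlt⟩ := ha
  rw [hF, Finset.coe_image] at haF
  obtain ⟨s, hs, rfl⟩ := haF
  refine ⟨s, Finset.mem_coe.mp hs, rfl, hs, fun x hx hne => ?_⟩
  have hmem : o + x ∈ (↑F : Set Expo) := by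
    rw [hF, Finset.coe_image]; exact ⟨x, hx, rfl⟩
  have hne' : o + x ≠ o + s := fun h => hne (add_left_cancel h)
  have := hlt _ hmem hne'
  rw [wt_add, wt_add] at this
  linarith

/-- All strict tops of translates of ONE shape sit at the same relative position: if `a` is the strict `ξ`-top of
`o + S` and `s⋆` is the strict `ξ`-top of `S`, then `a = o + s⋆`. [folklore] -/
theorem top_eq_add_of_shape {ξ : Fin 2 → ℝ} {S : Finset Expo} {o a s₀ : Expo} {F : Finset Expo}
    (hF : F = S.image (o + ·)) (ha : IsStrictTop ξ ↑F a) (hs₀ : IsStrictTop ξ ↑S s₀) : a = o + s₀ := by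
  obtain ⟨s, -, rfl, hs⟩ := exists_top_of_shape hF ha
  rw [isStrictTop_unique_of_shape hs hs₀]

/-- A support point of a translate `o + S` other than the top `o + s₀` is `o + x` with `x ∈ S`, `x ≠ s₀`.
[folklore] -/
theorem exists_rel_of_shape {S : Finset Expo} {o s₀ p : Expo} {F : Finset Expo} (hF : F = S.image (o + ·))
    (hp : p ∈ F) (hne : p ≠ o + s₀) : ∃ x ∈ S, x ≠ s₀ ∧ p = o + x := by
  classical
  rw [hF, Finset.mem_image] at hp
  obtain ⟨x, hx, rfl⟩ := hp
  exact ⟨x, hx, fun h => hne (by rw [h]), rfl⟩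

/-! ### The charted tails of a common shape lie in a common pair -/

/-- A shape with at most three points has, besides `s₀`, at most two points `x₁, x₂`. [folklore] -/
theorem exists_pair_of_card_le_three {S : Finset Expo} (hS : S.card ≤ 3) (s₀ : Expo) (hs₀ : s₀ ∈ S) :
    ∃ x₁ x₂ : Expo, ∀ x ∈ S, x ≠ s₀ → x = x₁ ∨ x = x₂ := by
  classical
  have hcard : (S.erase s₀).card ≤ 2 := by
    rw [Finset.card_erase_of_mem hs₀]; omega
  obtain ⟨l, hl, hnd⟩ : ∃ l : List Expo, l.toFinset = S.erase s₀ ∧ l.length ≤ 2 := by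
    refine ⟨(S.erase s₀).toList, Finset.toList_toFinset _, ?_⟩
    rw [Finset.length_toList]; exact hcard
  have hmem : ∀ x ∈ S, x ≠ s₀ → x ∈ l := by
    intro x hx hne
    rw [← List.mem_toFinset, hl, Finset.mem_erase]
    exact ⟨hne, hx⟩
  match l, hnd, hmem with
  | [], _, hmem => exact ⟨s₀, s₀, fun x hx hne => absurd (hmem x hx hne) (by simp)⟩
  | [y], _, hmem => exact ⟨y, y, fun x hx hne => Or.inl (by simpa using hmem x hx hne)⟩
  | [y₁, y₂], _, hmem => exact ⟨y₁, y₂, fun x hx hne => by simpa using hmem x hx hne⟩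
  | _ :: _ :: _ :: _, hnd, _ => simp at hnd

/-- The chart image of a relative tail, as an exponent vector: an exponent vector `d` whose coordinates are the
(hence nonnegative) integers `ρ₀, ρ₁` is `single 0 ρ₀ + single 1 ρ₁`. [folklore] -/
theorem eq_chartVec {ρ₀ ρ₁ : ℤ} {d : Expo} (h0 : ((d 0 : ℕ) : ℤ) = ρ₀) (h1 : ((d 1 : ℕ) : ℤ) = ρ₁) :
    d = Finsupp.single 0 ρ₀.toNat + Finsupp.single 1 ρ₁.toNat := by
  have e0 : d 0 = ρ₀.toNat := by rw [← h0, Int.toNat_natCast]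
  have e1 : d 1 = ρ₁.toNat := by rw [← h1, Int.toNat_natCast]
  ext i
  fin_cases i <;> simp [e0, e1]

/-- Relative tails of a translate: `(o + x) − (o + s₀) = x − s₀` coordinatewise in `ℤ`. [folklore] -/
theorem rel_tail_coord (o x s₀ : Expo) (k : Fin 2) :
    ((((o + x : Expo) k : ℕ) : ℤ) - (((o + s₀ : Expo) k : ℕ) : ℤ)) = ((x k : ℕ) : ℤ) - ((s₀ k : ℕ) : ℤ) := by
  simp only [Finsupp.coe_add, Pi.add_apply, Nat.cast_add]
  ring

/-- STUB 3 transports counts: a bound on finite sets of visible points of `supp D` bounds the (finite) visible set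
of the normalised difference (the landed `stub_logLinearisation`; same statement as the line reduction's
`visible_ncard_le_of`, restated here to keep this file out of the route file's import cone). [folklore] -/
theorem visible_ncard_le_logBound {u v : Fin m → MvPolynomial (Fin 2) ℂ} {N : ℕ}
    (hu : ∀ j, coeff 0 (u j) = 0) (hv : ∀ j, coeff 0 (v j) = 0)
    (hN : ∀ T : Finset Expo, (↑T ⊆ logVisible u v) → T.card ≤ N) :
    (visible u v).ncard ≤ N := by
  classical
  have hfin : (visible u v).Finite :=
    (tailDiff u v).support.finite_toSet.subset fun _ ⟨_, _, hl⟩ => hl.1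
  rw [Set.ncard_eq_toFinset_card _ hfin]
  refine hN _ ?_
  intro l hl
  have hl' : l ∈ visible u v := by simpa using hl
  obtain ⟨ξ, hξ, htop⟩ := hl'
  exact ⟨ξ, hξ, (stub_logLinearisation m u v hu hv ξ hξ l).1 htop⟩

/-! ### The hidden count of a common-shape pencil: `≤ 2m` per cancelling sector -/

/-- **Per-sector count.** For a pencil of common shape `S`, `#S ≤ 3`, every cancelling top-assignment has at most
`2m` hidden vertices: structured chart ⇒ all `2m` normalised tails supported in a common pair `{e₁, e₂}` ⇒
`#hidden ≤ #visible ≤ #logVisible-sets ≤ 2m` by STUB 3 and the common-cone rung. [folklore] -/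
theorem hidden_ncard_le_of_commonShape (S : Finset Expo) (hS : S.card ≤ 3)
    (f g : Fin m → MvPolynomial (Fin 2) ℂ) (o o' : Fin m → Expo)
    (hf : ∀ j, (f j).support = S.image (o j + ·)) (hg : ∀ j, (g j).support = S.image (o' j + ·))
    (a b : Fin m → Expo) (hc : Cancelling f g a b) : (hidden f g a b).ncard ≤ 2 * m := by
  classical
  by_cases hne : (hidden f g a b).Nonempty
  swap
  · rw [Set.not_nonempty_iff_eq_empty.mp hne, Set.ncard_empty]; exact Nat.zero_le _
  obtain ⟨l₀, ξ₀, hfa, hgb, -⟩ := hne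
  have hf3 : ∀ j, (f j).support.card ≤ 3 := fun j => by
    rw [hf j]; exact Finset.card_image_le.trans hS
  have hg3 : ∀ j, (g j).support.card ≤ 3 := fun j => by
    rw [hg j]; exact Finset.card_image_le.trans hS
  obtain ⟨r₁, r₂, -, u, v, hu, hv, hsu, hsv, hle⟩ :=
    chartNormalisation_structured m 3 f g hf3 hg3 a b hc
  refine hle.trans (visible_ncard_le_logBound (fun j => (hu j).1) (fun j => (hv j).1) ?_)
  -- the common relative top `s₀` (read off any factor; `m ≥ 1` since the hidden set is nonempty)
  rcases Nat.eq_zero_or_pos m with hm | hm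
  · subst hm
    intro T hT
    refine (Finset.card_eq_zero.2 (Finset.eq_empty_of_forall_notMem fun l hl => ?_)).le.trans (Nat.zero_le _)
    obtain ⟨ξ, -, hmem, -⟩ := hT (Finset.mem_coe.2 hl)
    apply hmem
    show logDiff u v l = 0
    simp [logDiff]
  obtain ⟨s₀, hs₀S, ha0, hs₀⟩ := exists_top_of_shape (hf ⟨0, hm⟩) (hfa ⟨0, hm⟩)
  have haj : ∀ j, a j = o j + s₀ := fun j => top_eq_add_of_shape (hf j) (hfa j) hs₀
  have hbj : ∀ j, b j = o' j + s₀ := fun j => top_eq_add_of_shape (hg j) (hgb j) hs₀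
  obtain ⟨x₁, x₂, hx⟩ := exists_pair_of_card_le_three hS s₀ hs₀S
  -- the common pair of charted tails
  set e₁ : Expo := Finsupp.single 0
      (r₁ 0 * (((x₁ 0 : ℕ) : ℤ) - ((s₀ 0 : ℕ) : ℤ)) + r₁ 1 * (((x₁ 1 : ℕ) : ℤ) - ((s₀ 1 : ℕ) : ℤ))).toNat +
    Finsupp.single 1
      (r₂ 0 * (((x₁ 0 : ℕ) : ℤ) - ((s₀ 0 : ℕ) : ℤ)) + r₂ 1 * (((x₁ 1 : ℕ) : ℤ) - ((s₀ 1 : ℕ) : ℤ))).toNat with he₁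
  set e₂ : Expo := Finsupp.single 0
      (r₁ 0 * (((x₂ 0 : ℕ) : ℤ) - ((s₀ 0 : ℕ) : ℤ)) + r₁ 1 * (((x₂ 1 : ℕ) : ℤ) - ((s₀ 1 : ℕ) : ℤ))).toNat +
    Finsupp.single 1
      (r₂ 0 * (((x₂ 0 : ℕ) : ℤ) - ((s₀ 0 : ℕ) : ℤ)) + r₂ 1 * (((x₂ 1 : ℕ) : ℤ) - ((s₀ 1 : ℕ) : ℤ))).toNat with he₂
  have key : ∀ (x d : Expo), x ∈ S → x ≠ s₀ →
      ((d 0 : ℕ) : ℤ) = r₁ 0 * (((x 0 : ℕ) : ℤ) - ((s₀ 0 : ℕ) : ℤ)) + r₁ 1 * (((x 1 : ℕ) : ℤ) - ((s₀ 1 : ℕ) : ℤ)) →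
      ((d 1 : ℕ) : ℤ) = r₂ 0 * (((x 0 : ℕ) : ℤ) - ((s₀ 0 : ℕ) : ℤ)) + r₂ 1 * (((x 1 : ℕ) : ℤ) - ((s₀ 1 : ℕ) : ℤ)) →
      d ∈ ({e₁, e₂} : Finset Expo) := by
    intro x d hxS hxs h0 h1
    rw [Finset.mem_insert, Finset.mem_singleton]
    rcases hx x hxS hxs with rfl | rfl
    · exact Or.inl (eq_chartVec h0 h1)
    · exact Or.inr (eq_chartVec h0 h1)
  have hsub_u : ∀ j, (u j).support ⊆ {e₁, e₂} := by
    intro j d hd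
    obtain ⟨p, hp, hpa, h0, h1⟩ := hsu j d hd
    rw [haj j] at hpa h0 h1
    obtain ⟨x, hxS, hxs, rfl⟩ := exists_rel_of_shape (hf j) hp hpa
    rw [rel_tail_coord, rel_tail_coord] at h0 h1
    exact key x d hxS hxs h0 h1
  have hsub_v : ∀ j, (v j).support ⊆ {e₁, e₂} := by
    intro j d hd
    obtain ⟨p, hp, hpb, h0, h1⟩ := hsv j d hd
    rw [hbj j] at hpb h0 h1
    obtain ⟨x, hxS, hxs, rfl⟩ := exists_rel_of_shape (hg j) hp hpb
    rw [rel_tail_coord, rel_tail_coord] at h0 h1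
    exact key x d hxS hxs h0 h1
  exact engineCommonConeRung m e₁ e₂ u v (fun j => ⟨(hu j).1, hsub_u j⟩) (fun j => ⟨(hv j).1, hsub_v j⟩)

/-! ### The theorem -/

/-- **Pencils of common-shape trinomials have polynomially many Newton vertices.** If every `f j` and every `g j`
(`j < m`, bivariate complex polynomials) is supported on a translate of ONE set `S ⊂ ℕ²` with at most three points
— e.g. genuine trinomials `c_j X^{o_j}(1 + α_j X^{d₁} + β_j X^{d₂})`, `c'_j X^{o'_j}(1 + α'_j X^{d₁} + β'_j X^{d₂})`
with all coefficients nonzero — then `#vert Newt(∏ f − ∏ g) ≤ 12 m² + 12 m + 2`. End-to-end through the line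
`formal-log-linearisation` (stub 1 by name, structured stub 2, stub 3, common-cone rung); the engine is not used.
A partial range of the OPEN crux `TwoProducts` (stmt-ValiantsHypothesis-5906). [folklore] -/
theorem twoProducts_commonShape (S : Finset Expo) (hS : S.card ≤ 3)
    (f g : Fin m → MvPolynomial (Fin 2) ℂ) (o o' : Fin m → Expo)
    (hf : ∀ j, (f j).support = S.image (o j + ·)) (hg : ∀ j, (g j).support = S.image (o' j + ·)) :
    newtonVertexCount (∏ j, f j - ∏ j, g j) ≤ 12 * m ^ 2 + 12 * m + 2 := by
  classical
  have hf3 : ∀ j, (f j).support.card ≤ 3 := fun j => by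
    rw [hf j]; exact Finset.card_image_le.trans hS
  have hg3 : ∀ j, (g j).support.card ≤ 3 := fun j => by
    rw [hg j]; exact Finset.card_image_le.trans hS
  have h := stub_sectorDecomposition m 3 f g hf3 hg3 (2 * m)
    (fun a b hc => hidden_ncard_le_of_commonShape S hS f g o o' hf hg a b hc)
  have e : 4 * m * 3 + 2 + 2 * m * 3 * (2 * m) = 12 * m ^ 2 + 12 * m + 2 := by ring
  rw [e] at h
  exact h

/-! ### The linear bound: a common-shape pencil realises at most `#S` top-assignments -/

/-- **Assignment count of a common-shape pencil.** A realised top-assignment (simultaneous strict tops of all `2m`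
supports for one weight) of a pencil of common shape `S` is determined by the relative position `s⋆ ∈ S` of the
tops (`top_eq_add_of_shape`), so at most `#S` assignments are ever realised (`m ≥ 1`). [folklore] -/
theorem assignmentCount_le_of_commonShape (hm : 0 < m) (S : Finset Expo)
    (f g : Fin m → MvPolynomial (Fin 2) ℂ) (o o' : Fin m → Expo)
    (hf : ∀ j, (f j).support = S.image (o j + ·)) (hg : ∀ j, (g j).support = S.image (o' j + ·))
    (T : Finset ((Fin m → Expo) × (Fin m → Expo)))
    (hT : ∀ p ∈ T, ∃ ξ : Fin 2 → ℝ, (∀ j, IsStrictTop ξ ↑(f j).support (p.1 j)) ∧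
      (∀ j, IsStrictTop ξ ↑(g j).support (p.2 j))) : T.card ≤ S.card := by
  classical
  -- the relative top of each realised assignment
  have key : ∀ p ∈ T, ∃ s ∈ S, p = (fun j => o j + s, fun j => o' j + s) := by
    intro p hp
    obtain ⟨ξ, hfa, hgb⟩ := hT p hp
    obtain ⟨s, hsS, -, hs⟩ := exists_top_of_shape (hf ⟨0, hm⟩) (hfa ⟨0, hm⟩)
    refine ⟨s, hsS, Prod.ext (funext fun j => ?_) (funext fun j => ?_)⟩
    · exact top_eq_add_of_shape (hf j) (hfa j) hs
    · exact top_eq_add_of_shape (hg j) (hgb j) hs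
  choose! σ hσS hσ using key
  have hinj : Set.InjOn σ ↑T := fun p hp p' hp' h => by
    rw [hσ p hp, hσ p' hp', h]
  rw [← Finset.card_image_of_injOn hinj]
  exact Finset.card_le_card fun s hs => by
    obtain ⟨p, hp, rfl⟩ := Finset.mem_image.1 hs
    exact hσS p hp

/-- **Pencils of common-shape trinomials have LINEARLY many Newton vertices:** under the hypotheses of
`twoProducts_commonShape` (all `2m` factors supported on translates of one set `S ⊂ ℕ²`, `#S ≤ 3`),
`#vert Newt(∏ f − ∏ g) ≤ 6m` — at most `#S ≤ 3` realised top-assignments (`assignmentCount_le_of_commonShape`),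
each exposing at most `max(2, 2m)` vertices (`hidden_ncard_le_of_commonShape` and the parametrised sector
decomposition `newtonVertexCount_le_of_assignmentCount`). A partial range of the OPEN crux `TwoProducts`
(stmt-ValiantsHypothesis-5906); the engine is not used. [folklore] -/
theorem twoProducts_commonShape_linear (S : Finset Expo) (hS : S.card ≤ 3)
    (f g : Fin m → MvPolynomial (Fin 2) ℂ) (o o' : Fin m → Expo)
    (hf : ∀ j, (f j).support = S.image (o j + ·)) (hg : ∀ j, (g j).support = S.image (o' j + ·)) :
    newtonVertexCount (∏ j, f j - ∏ j, g j) ≤ 6 * m := by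
  classical
  rcases Nat.eq_zero_or_pos m with hm | hm
  · subst hm
    have : (∏ j : Fin 0, f j - ∏ j : Fin 0, g j) = 0 := by simp
    rw [this, newtonVertexCount_zero]
  rcases S.eq_empty_or_nonempty with hS0 | hSne
  · -- empty shape: every factor vanishes
    subst hS0
    have hf0 : f ⟨0, hm⟩ = 0 := by
      rw [← MvPolynomial.support_eq_empty, hf]; simp
    have hPf : ∏ j, f j = 0 := Finset.prod_eq_zero (Finset.mem_univ _) hf0
    have hg0 : g ⟨0, hm⟩ = 0 := by
      rw [← MvPolynomial.support_eq_empty, hg]; simp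
    have hPg : ∏ j, g j = 0 := Finset.prod_eq_zero (Finset.mem_univ _) hg0
    rw [hPf, hPg, sub_zero, newtonVertexCount_zero]
    exact Nat.zero_le _
  have hf0 : ∀ j, f j ≠ 0 := fun j => by
    rw [Ne, ← MvPolynomial.support_eq_empty, hf j, Finset.image_eq_empty]
    exact hSne.ne_empty
  have hg0 : ∀ j, g j ≠ 0 := fun j => by
    rw [Ne, ← MvPolynomial.support_eq_empty, hg j, Finset.image_eq_empty]
    exact hSne.ne_empty
  have h := newtonVertexCount_le_of_assignmentCount f g hf0 hg0 S.card (2 * m)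
    (fun T hT => assignmentCount_le_of_commonShape hm S f g o o' hf hg T hT)
    (fun a b hc => hidden_ncard_le_of_commonShape S hS f g o o' hf hg a b hc)
  have hmax : max 2 (2 * m) = 2 * m := max_eq_right (by omega)
  rw [hmax] at h
  calc newtonVertexCount (∏ j, f j - ∏ j, g j) ≤ S.card * (2 * m) := h
    _ ≤ 3 * (2 * m) := Nat.mul_le_mul_right _ hS
    _ = 6 * m := by ring

end Summit.ValiantsHypothesis.ValiantsHypothesis.Theorems.NewtonUnitEquations.TwoProducts.FormalLogLinearisation

end
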